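import Mathlib
import HarnessLib
import Summits.AnomalousDissipation.AnomalousDissipation.Theses.LimitingAbsorption

/-!
# Line `Sketch` — lead skeleton for the crux `LimitingAbsorption.RelaxingFamily`
  (stmt-AnomalousDissipation-15009), lead prover-line-stmt-AnomalousDissipation-15009-0, 2026-08-16

Source line: `Cruxes/RelaxingFamily/SketchIdeator2.lean` (crux-ideate r1, ideator 2; card
`Cruxes/RelaxingFamily/Ideas/ergodic-sup-phase-collapse.md`), reshaped into the registered shape
(`stub_*` + `RelaxingFamily_of`). The ideator's file has no `RelaxingFamily_of`; its only arrow into the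
crux is `hull_imp_relaxingFamily_holds : HullRelaxingFamily → RelaxingFamily`, so the composition has
exactly ONE stub:

* `stub_hull : HullRelaxingFamily` — for each level `j` a nonempty, forward-shift-invariant family `𝒱 j`
  of admissible (global Leray–Hopf from its own slice, locally bounded, mean energy `≤ E`) trajectories of
  planar NS(ν_j, g), `ν_j → 0`, on which the phase-0 decay clause holds with one `(C, γ)`. This is the
  card's `C⁺ ⇒ HullRelaxingFamily` target with `C⁺ = InvariantSetOddContraction` (its K1) folded in; the
  card grades K1/K3 "no invariant set of steadily forced planar NS with that structure is known at any ν".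
* `RelaxingFamily_of : RelaxingFamily` — the ideator's bookkeeping proof `hull_imp_relaxingFamily_holds` inlined (pick `v_j ∈ 𝒱 j`, datum
  `v_j 0`; phase `s` for `v_j` is phase `0` for the shifted trajectory, which lies in `𝒱 j`).

Everything except `stub_hull` elaborates sorry-free.
-/

noncomputable section

open MeasureTheory Set Filter Topology Function

namespace Summit.AnomalousDissipation.AnomalousDissipation.Cruxes.RelaxingFamily.Sketch

set_option linter.dupNamespace false

open Literature.Analysis.FunctionSpaces Literature.Analysis.FunctionSpaces.Torus
open Literature.Analysis.FluidPDE Literature.Analysis.FluidPDE.Torus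
open Summit.AnomalousDissipation.AnomalousDissipation.Theses.LimitingAbsorption

/-- The unit flat 2-torus (local notation). -/
local notation "𝕋²" => UnitAddTorus (Fin 2)
/-- Planar vectors (local notation). -/
local notation "E²" => EuclideanSpace ℝ (Fin 2)

/-- `DecayClause κ u h C γ S`: from every phase `s ∈ S`, every weak solution of
`∂ₜθ + u(s+·)·∇θ = κΔθ`, `θ(0) = h` on `[0,T)` obeys `‖θ(t)‖² ≤ C e^{-γt} ‖h‖²` for a.e.
`t ∈ (0,T)`. With `S = Ici 0` this is literally the last conjunct of `RelaxingFamily`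
(ideator 2's `SketchIdeator2.DecayClause`, verbatim). -/
def DecayClause (κ : ℝ) (u : ℝ → 𝕋² → E²) (h : 𝕋² → ℝ) (C γ : ℝ) (S : Set ℝ) : Prop :=
  ∀ s ∈ S, ∀ (T : ℝ) (θ : ℝ → 𝕋² → ℝ),
    IsWeakScalarTransportOn T κ (fun t => u (s + t)) h θ →
      ∀ᵐ t ∂(volume.restrict (Ioo (0 : ℝ) T)),
        scalarL2Sq (θ t) ≤ C * Real.exp (-(γ * t)) * scalarL2Sq h

/-- Standing side conditions on one planar Leray–Hopf trajectory at viscosity `κ` with steady force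
`g`: global LH from its own initial slice, locally bounded on every `(0,T)`, mean energy `≤ E`
(ideator 2's `SketchIdeator2.AdmissibleTrajectory`, verbatim). -/
def AdmissibleTrajectory (κ E : ℝ) (g : 𝕋² → E²) (v : ℝ → 𝕋² → E²) : Prop :=
  IsGlobalLerayHopf κ (fun _ => g) (v 0) v ∧
  (∀ T : ℝ, 0 < T → MemLp (stLift v) ⊤ (volume.restrict (Ioo (0 : ℝ) T ×ˢ univ))) ∧
  meanEnergy v ≤ E

/-- HULL FORM of the crux (ideator 2's `SketchIdeator2.HullRelaxingFamily`, verbatim): for each level `j`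
a nonempty, forward-shift-invariant family `𝒱 j` of admissible trajectories on which the decay clause
holds FROM PHASE 0 with one `(C, γ)`. -/
def HullRelaxingFamily : Prop :=
  ∃ (g : 𝕋² → E²) (h : 𝕋² → ℝ), IsSmooth g ∧ IsDivFree g ∧ HasZeroMean g ∧ IsSmooth h ∧
    HasZeroMean h ∧ h ≠ 0 ∧
    ∃ (ν : ℕ → ℝ) (𝒱 : ℕ → Set (ℝ → 𝕋² → E²)) (E C γ : ℝ),
      (∀ j, 0 < ν j) ∧ Tendsto ν atTop (𝓝 0) ∧ 0 ≤ C ∧ 0 < γ ∧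
      (∀ j, (𝒱 j).Nonempty) ∧
      (∀ j, ∀ v ∈ 𝒱 j, ∀ s : ℝ, 0 ≤ s → (fun t => v (s + t)) ∈ 𝒱 j) ∧
      (∀ j, ∀ v ∈ 𝒱 j, AdmissibleTrajectory (ν j) E g v) ∧
      (∀ j, ∀ v ∈ 𝒱 j, DecayClause (ν j) v h C γ {0})

/-- **Stub (the line's only one; the residual).** A witness of the hull form: some steady smooth
div-free mean-zero `g`, smooth mean-zero `h ≠ 0`, `ν_j → 0`, and per level a nonempty forward-invariant
family of admissible NS(ν_j, g) trajectories relaxing `h` from phase `0` at one `ν`-uniform exponential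
rate. Card `ergodic-sup-phase-collapse`: K1 `InvariantSetOddContraction` via K3 `HyperbolicSetExists`,
certified by K2 (periodic census); none is a printed theorem. -/
theorem stub_hull : HullRelaxingFamily := by
  sorry

/-- **Composition**: the line `Sketch` closes the crux `RelaxingFamily` by name modulo `stub_hull`
(ideator 2's `hull_imp_relaxingFamily_holds`, re-typed so that the conclusion is literally the route decl):
pick any `v_j ∈ 𝒱 j`, datum `v_j 0`; the phase-`s` clause for `v_j` is the phase-`0` clause for the
shifted trajectory, which lies in `𝒱 j`. [folklore] -/
theorem RelaxingFamily_of : RelaxingFamily := by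
  obtain ⟨g, h, hg, hgd, hgm, hh, hhm, hh0, ν, 𝒱, E, C, γ, hν, hνlim, hC, hγ, hne, hshift, hadm,
    hdec⟩ := stub_hull
  choose v hv using hne
  refine ⟨g, h, hg, hgd, hgm, hh, hhm, hh0, ν, fun j => v j 0, v, hν, hνlim,
    fun j => (hadm j (v j) (hv j)).1, fun j => (hadm j (v j) (hv j)).2.1,
    ⟨E, fun j => (hadm j (v j) (hv j)).2.2⟩, C, γ, hC, hγ, ?_⟩
  intro j s hs T θ hθ
  have hw : (fun t => v j (s + t)) ∈ 𝒱 j := hshift j (v j) (hv j) s hs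
  have key := hdec j _ hw 0 (Set.mem_singleton 0) T θ
  have heq : (fun t => (fun t => v j (s + t)) (0 + t)) = fun t => v j (s + t) := by
    funext t; simp
  rw [heq] at key
  exact key hθ

end Summit.AnomalousDissipation.AnomalousDissipation.Cruxes.RelaxingFamily.Sketch

end
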